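import Literature.Analysis.UnboundedOperators.UnitaryGroupGenerator
import Literature.MathematicalPhysics.QuantumLattice.QuasiLocalAlgebraProofs
import HarnessLib

/-!
# Ground states: the GNS unitary group and positivity of the GNS Hamiltonian
(trunk QLatticeAQFT, proofs layer for item Q15 `QuasiLocalAlgebra`)

This file discharges the named fact `QLattice.QuasiLocalAlgebra.exists_gnsHamiltonian` of
`Literature/MathematicalPhysics/QuantumLattice/QuasiLocalAlgebra.lean`:

> for a strongly continuous one-parameter group `τ` of ⋆-automorphisms of (the quasi-local)
> C⋆-algebra and a ground state `ω` (`-i ω(a⋆ δ(a)) ≥ 0` on `D(δ)`), there is a unique strongly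
> continuous one-parameter unitary group `U_ω` on the GNS space implementing `τ`
> (`π_ω(τ_t(a)) = U_ω(t) π_ω(a) U_ω(t)⋆`) and fixing `Ω_ω`, and its Stone generator
> `H_ω` (`U_ω(t) = e^{itH_ω}`, item C4 `UnitaryRep.hamiltonian`) is positive,

as `exists_gnsHamiltonian_holds`, through the general C⋆-algebraic statement
`State.IsGroundState.existsUnique_gnsImplementation`. Nothing is specific to the lattice. The
printed sources are Sakai, *Operator Algebras in Dynamical Systems* (1991), Def. 4.2.1,
Prop. 4.2.2 (ground states are invariant), pp. 123–124 and Prop. 4.2.3 (the covariant GNS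
representation `U_φ(t) a_φ = (α_t(a))_φ`, `H_φ ≥ 0`, `H_φ 1_φ = 0`); Bratteli–Robinson I (1987)
Cor. 2.3.17 (unique unitary implementation of an invariant automorphism, `U_ω Ω_ω = Ω_ω`) and
p. 236 (strong continuity of `U_ω`); Bratteli–Robinson II (1997) Def. 5.3.18, Prop. 5.3.19 (3),
Cor. 5.3.20 (the statement vendored in item Q15).

## Contents and proof architecture

* Invariance of ground states, `ω ∘ τ_t = ω` (**Sakai Prop. 4.2.2**; Bratteli–Robinson II
  Prop. 5.3.19), is the already discharged named fact `State.IsGroundState.apply_dynamics`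
  (`State.IsGroundState.apply_dynamics_holds` in `QuasiLocalAlgebraProofs`), which we import
  together with the smoothing identity `IsAutomorphismGroup.hasDerivAt_integral`
  (`∫₀ᵗ τ_s(a) ds ∈ D(δ)`, `δ(∫₀ᵗ τ_s(a) ds) = τ_t(a) - a`).
* `State.gnsMap ω : A →L[ℂ] 𝓗_ω`, `a ↦ [a] = π_ω(a) Ω_ω` (contractive), with `⟪[a], [b]⟫ = ω(a⋆b)`,
  `π_ω(a)[b] = [ab]`, `π_ω(a) Ω_ω = [a]`, dense range and an induction principle
  (Bratteli–Robinson I §2.3.3, the classes `ψ_A` in the proof of Thm. 2.3.16).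
* `State.gnsUnitaryGroup hτ hinv : OneParameterUnitaryGroup 𝓗_ω` for a `τ`-invariant state
  (**Bratteli–Robinson I Cor. 2.3.17; Sakai pp. 123–124**): `U_ω(t)` is the completion of the
  `ω`-isometry `[x] ↦ [τ_t x]` of the pre-GNS space; group law, `U_ω(t)⋆ = U_ω(-t)`, unitarity,
  strong continuity (uniform approximation from the classes `[a]`), covariance
  `isGNSImplementationOf_gnsUnitaryGroup` and `U_ω(t) Ω_ω = Ω_ω`.
* `State.IsGNSImplementationOf.unique`: any implementing group satisfies `U(t)[a] = [τ_t a]` on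
  the dense set of classes (**BR I Cor. 2.3.17**, uniqueness).
* `State.hasPositiveEnergy_gnsUnitaryGroup` (**Sakai Prop. 4.2.3**, `H_ω ≥ 0`): by the mollifier
  criterion `UnitaryRep.hasPositiveEnergy_of_dense` of
  `Literature/Analysis/UnboundedOperators/UnitaryGroupGenerator.lean` on the classes `[a]`, since
  for `m = ∫₀ᵗ τ_s(a) ds ∈ D(δ)` with `δ(m) = τ_t(a) - a` the ground-state inequality gives
  `Im ⟪∫₀ᵗ U_ω(s)[a] ds, U_ω(t)[a] - [a]⟫ = Im ω(m⋆ δ(m)) = Re (-i ω(m⋆ δ(m))) ≥ 0`. (Sakai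
  instead restricts `H_φ` to `D(δ)_φ` and uses a core argument; the conclusion `(H_φ ξ, ξ) ≥ 0`
  on `D(H_φ)` is the same.) Symmetry of `H_ω` is `UnitaryRep.hamiltonian_isSymmetric`
  (skew-symmetry of the Stone generator).
* `State.IsGroundState.existsUnique_gnsImplementation` assembles these, and
  `QLattice.QuasiLocalAlgebra.exists_gnsHamiltonian_holds` specialises to the quasi-local algebra.

## Sources

* S. Sakai, *Operator Algebras in Dynamical Systems* (Cambridge UP 1991), §4.2: Def. 4.2.1,
  Prop. 4.2.2, Prop. 4.2.3 (pp. 123–124). [Sakai1991]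
* O. Bratteli, D. W. Robinson, *Operator Algebras and Quantum Statistical Mechanics I* (2nd ed.,
  1987), §2.3.3, Thm. 2.3.16, Cor. 2.3.17, §3.2.4 p. 236. [BratteliRobinsonI1987]
* O. Bratteli, D. W. Robinson, *Operator Algebras and Quantum Statistical Mechanics II* (2nd ed.,
  1997), Def. 5.3.18, Prop. 5.3.19, Cor. 5.3.20. [BratteliRobinsonII1997]
* K.-J. Engel, R. Nagel, *One-Parameter Semigroups for Linear Evolution Equations* (2000),
  Lemma II.1.3, Thm. II.1.4.

## Design notes

* Hypotheses are exactly those of the named fact: `IsAutomorphismGroup τ` and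
  `ω.IsGroundState τ` over `[CStarAlgebra A] [PartialOrder A] [StarOrderedRing A]`; the
  invariance `hinv : ∀ t a, ω (τ t a) = ω a` is threaded explicitly through the construction of
  `U_ω` (which needs only invariance, not the ground-state property).
* New definitions (`starAlgEquivCLM`, `State.gnsMap`, `State.gnsDynamicsPre`,
  `State.gnsDynamicsCLM`, `State.gnsUnitaryGroup`) are concrete constructions with `rfl`/`simp`
  unfolding lemmas; no `sorry`, no new axioms
  (`#print axioms exists_gnsHamiltonian_holds`: `propext`, `Classical.choice`, `Quot.sound`).
-/

noncomputable section

open Filter Topology ComplexConjugate Complex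
open scoped InnerProductSpace ComplexOrder

namespace Literature.MathematicalPhysics.QuantumLattice

section CStar

variable {A : Type*} [CStarAlgebra A]

/-- A ⋆-automorphism of a C⋆-algebra as a continuous linear map (it is isometric, Mathlib
`StarAlgEquiv.isometry`). [folklore] -/
def starAlgEquivCLM (e : A ≃⋆ₐ[ℂ] A) : A →L[ℂ] A where
  toFun := e
  map_add' := map_add e
  map_smul' := map_smul e
  cont := (StarAlgEquiv.isometry e).continuous

/-- Unfolding lemma for `starAlgEquivCLM`. [folklore] -/
@[simp]
theorem starAlgEquivCLM_apply (e : A ≃⋆ₐ[ℂ] A) (a : A) : starAlgEquivCLM e a = e a := rfl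

end CStar

/-! ### The GNS map `a ↦ π_ω(a) Ω_ω` -/

section GNS

variable {A : Type*} [CStarAlgebra A] [PartialOrder A] [StarOrderedRing A]

namespace State

variable (ω : State A)

/-- States are contractive on positive elements: `re ω(a⋆ a) ≤ ‖a‖²` (from Mathlib
`PositiveLinearMap.norm_apply_le_of_nonneg` and `ω 1 = 1`; Bratteli–Robinson I Prop. 2.3.11).
[folklore] -/
theorem re_apply_star_mul_self_le (a : A) : (ω (star a * a)).re ≤ ‖a‖ ^ 2 := by
  have h1 : ‖ω (star a * a)‖ ≤ ‖a‖ ^ 2 := by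
    have := ω.toPositiveLinearMap.norm_apply_le_of_nonneg (star a * a) (star_mul_self_nonneg a)
    rw [coe_toPositiveLinearMap, ω.map_one, norm_one, one_mul, CStarRing.norm_star_mul_self,
      ← sq] at this
    exact this
  exact (Complex.re_le_norm _).trans h1

/-- The **GNS map** `a ↦ [a] = π_ω(a) Ω_ω ∈ 𝓗_ω` (the image of `a` in the completion of the
pre-GNS space `A/N_ω`), as a continuous linear map `A →L[ℂ] 𝓗_ω`; it is contractive,
`‖[a]‖² = ω(a⋆a) ≤ ‖a‖²` (Bratteli–Robinson I §2.3.3, proof of Thm. 2.3.16: the classes `ψ_A`).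
[cite: BratteliRobinsonI1987, §2.3.3] -/
def gnsMap : A →L[ℂ] ω.gnsSpace :=
  LinearMap.mkContinuous
    { toFun := fun a =>
        ((ω.toPositiveLinearMap.toPreGNS a : ω.toPositiveLinearMap.PreGNS) : ω.gnsSpace)
      map_add' := fun a b => by
        simp only [map_add, UniformSpace.Completion.coe_add]
      map_smul' := fun c a => by
        simp only [map_smul, UniformSpace.Completion.coe_smul, RingHom.id_apply] }
    1 fun a => by
      simp only [LinearMap.coe_mk, AddHom.coe_mk, one_mul, UniformSpace.Completion.norm_coe,
        PositiveLinearMap.preGNS_norm_def, PositiveLinearMap.ofPreGNS_toPreGNS,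
        coe_toPositiveLinearMap]
      rw [Real.sqrt_le_left (norm_nonneg a)]
      exact ω.re_apply_star_mul_self_le a

/-- Unfolding lemma for the GNS map. [folklore] -/
theorem gnsMap_apply (a : A) :
    ω.gnsMap a = ((ω.toPositiveLinearMap.toPreGNS a : ω.toPositiveLinearMap.PreGNS) : ω.gnsSpace) :=
  rfl

/-- Every element of the dense image of the pre-GNS space is a value of the GNS map. [folklore] -/
@[simp]
theorem gnsMap_ofPreGNS (b : ω.toPositiveLinearMap.PreGNS) :
    ω.gnsMap (ω.toPositiveLinearMap.ofPreGNS b) = (b : ω.gnsSpace) := by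
  rw [gnsMap_apply, PositiveLinearMap.toPreGNS_ofPreGNS]

/-- The GNS inner product: `⟪[a], [b]⟫ = ω(a⋆ b)` (Bratteli–Robinson I §2.3.3). [folklore] -/
@[simp]
theorem inner_gnsMap (a b : A) : ⟪ω.gnsMap a, ω.gnsMap b⟫_ℂ = ω (star a * b) := by
  rw [gnsMap_apply, gnsMap_apply, UniformSpace.Completion.inner_coe,
    PositiveLinearMap.preGNS_inner_def]
  simp

/-- The GNS representation acts on the classes by left multiplication: `π_ω(a) [b] = [a b]`
(Bratteli–Robinson I §2.3.3). [folklore] -/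
@[simp]
theorem gnsRep_gnsMap (a b : A) : ω.gnsRep a (ω.gnsMap b) = ω.gnsMap (a * b) := by
  have h : ω.gnsRep a = ω.toPositiveLinearMap.gnsNonUnitalStarAlgHom a := rfl
  rw [h, gnsMap_apply, gnsMap_apply, PositiveLinearMap.gnsNonUnitalStarAlgHom_apply_coe]
  simp

/-- The cyclic vector is the class of `1`: `Ω_ω = [1]` (Bratteli–Robinson I §2.3.3). [folklore] -/
theorem gnsVector_eq_gnsMap_one : ω.gnsVector = ω.gnsMap 1 := rfl

/-- `π_ω(a) Ω_ω = [a]` (Bratteli–Robinson I §2.3.3; this is the named fact `gnsRep_gnsVector`).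
[folklore] -/
@[simp]
theorem gnsRep_gnsVector_eq_gnsMap (a : A) : ω.gnsRep a ω.gnsVector = ω.gnsMap a := by
  rw [gnsVector_eq_gnsMap_one, gnsRep_gnsMap, mul_one]

/-- The GNS map has dense range (the completion of the pre-GNS space). [folklore] -/
theorem denseRange_gnsMap : DenseRange ω.gnsMap := by
  have : (ω.gnsMap : A → ω.gnsSpace) =
      ((↑) : ω.toPositiveLinearMap.PreGNS → ω.gnsSpace) ∘ ω.toPositiveLinearMap.toPreGNS := rfl
  rw [this]
  exact UniformSpace.Completion.denseRange_coe.comp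
    ω.toPositiveLinearMap.toPreGNS.surjective.denseRange (UniformSpace.Completion.continuous_coe _)

/-- Induction on the GNS space along the GNS map: a closed property holding on all classes `[a]`
holds everywhere. [folklore] -/
theorem gnsMap_induction {p : ω.gnsSpace → Prop} (x : ω.gnsSpace) (hc : IsClosed {x | p x})
    (ih : ∀ a : A, p (ω.gnsMap a)) : p x :=
  UniformSpace.Completion.induction_on x hc fun b => by
    simpa using ih (ω.toPositiveLinearMap.ofPreGNS b)

end State

/-! ### The GNS unitary group of an invariant automorphism group (BR I Cor. 2.3.17; Sakai 4.2.3) -/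

namespace State

variable {ω : State A} {τ : ℝ → (A ≃⋆ₐ[ℂ] A)}

/-- For a `τ`-invariant state, `[x] ↦ [τ_t x]` preserves the `ω`-seminorm on the pre-GNS space
(`‖[τ_t x]‖² = ω(τ_t(x⋆x)) = ω(x⋆x)`), hence is a continuous linear map there
(Sakai (1991), p. 123; Bratteli–Robinson I Cor. 2.3.17). [cite: Sakai1991, §4.2 p. 123] -/
def gnsDynamicsPre (hinv : ∀ (t : ℝ) (a : A), ω (τ t a) = ω a) (t : ℝ) :
    ω.toPositiveLinearMap.PreGNS →L[ℂ] ω.toPositiveLinearMap.PreGNS :=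
  LinearMap.mkContinuous
    (ω.toPositiveLinearMap.toPreGNS.toLinearMap ∘ₗ (starAlgEquivCLM (τ t)).toLinearMap ∘ₗ
      ω.toPositiveLinearMap.ofPreGNS.toLinearMap)
    1 fun x => by
      apply le_of_eq
      simp only [one_mul, LinearMap.coe_comp, LinearEquiv.coe_coe, ContinuousLinearMap.coe_coe,
        Function.comp_apply, starAlgEquivCLM_apply, PositiveLinearMap.preGNS_norm_def,
        PositiveLinearMap.ofPreGNS_toPreGNS, coe_toPositiveLinearMap, ← map_star, ← map_mul, hinv]

/-- Unfolding lemma for `gnsDynamicsPre`. [folklore] -/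
@[simp]
theorem gnsDynamicsPre_apply (hinv : ∀ (t : ℝ) (a : A), ω (τ t a) = ω a) (t : ℝ)
    (x : ω.toPositiveLinearMap.PreGNS) :
    gnsDynamicsPre hinv t x =
      ω.toPositiveLinearMap.toPreGNS (τ t (ω.toPositiveLinearMap.ofPreGNS x)) :=
  rfl

/-- The operator `U_ω(t)` on the GNS space of a `τ`-invariant state: the completion of
`[x] ↦ [τ_t x]` (Sakai (1991), p. 123; Bratteli–Robinson I Cor. 2.3.17).
[cite: Sakai1991, §4.2 p. 123] -/
def gnsDynamicsCLM (hinv : ∀ (t : ℝ) (a : A), ω (τ t a) = ω a) (t : ℝ) :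
    ω.gnsSpace →L[ℂ] ω.gnsSpace :=
  (gnsDynamicsPre hinv t).completion

/-- `U_ω(t) [a] = [τ_t a]` (Sakai (1991), p. 123). [cite: Sakai1991, §4.2 p. 123] -/
@[simp]
theorem gnsDynamicsCLM_gnsMap (hinv : ∀ (t : ℝ) (a : A), ω (τ t a) = ω a) (t : ℝ) (a : A) :
    gnsDynamicsCLM hinv t (ω.gnsMap a) = ω.gnsMap (τ t a) := by
  rw [gnsDynamicsCLM, gnsMap_apply, gnsMap_apply, ContinuousLinearMap.completion_apply_coe,
    gnsDynamicsPre_apply, PositiveLinearMap.ofPreGNS_toPreGNS]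

/-- `U_ω(0) = 1`. [cite: Sakai1991, §4.2 p. 124] -/
theorem gnsDynamicsCLM_zero (hτ : IsAutomorphismGroup τ)
    (hinv : ∀ (t : ℝ) (a : A), ω (τ t a) = ω a) : gnsDynamicsCLM hinv 0 = 1 := by
  ext x
  induction x using ω.gnsMap_induction with
  | hc => exact isClosed_eq (by fun_prop) (by fun_prop)
  | ih a => rw [gnsDynamicsCLM_gnsMap, hτ.map_zero_apply, one_apply_eq_self]

/-- The group law `U_ω(s + t) = U_ω(s) U_ω(t)` (Sakai (1991), p. 124). [cite: Sakai1991, §4.2 p. 124] -/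
theorem gnsDynamicsCLM_add (hτ : IsAutomorphismGroup τ)
    (hinv : ∀ (t : ℝ) (a : A), ω (τ t a) = ω a) (s t : ℝ) :
    gnsDynamicsCLM hinv (s + t) = gnsDynamicsCLM hinv s * gnsDynamicsCLM hinv t := by
  ext x
  induction x using ω.gnsMap_induction with
  | hc => exact isClosed_eq (by fun_prop) (by fun_prop)
  | ih a => simp only [gnsDynamicsCLM_gnsMap, mul_apply_eq_comp, hτ.map_add_apply]

/-- `U_ω(-t)` is the adjoint of `U_ω(t)`: `⟪U_ω(-t) x, y⟫ = ⟪x, U_ω(t) y⟫, from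
`ω((τ_{-t} a)⋆ b) = ω(τ_{-t}(a⋆ τ_t b)) = ω(a⋆ τ_t b)` (Bratteli–Robinson I Cor. 2.3.17;
Sakai (1991), p. 123). [cite: Sakai1991, §4.2 p. 123] -/
theorem adjoint_gnsDynamicsCLM (hτ : IsAutomorphismGroup τ)
    (hinv : ∀ (t : ℝ) (a : A), ω (τ t a) = ω a) (t : ℝ) :
    ContinuousLinearMap.adjoint (gnsDynamicsCLM hinv t) = gnsDynamicsCLM hinv (-t) := by
  symm
  rw [ContinuousLinearMap.eq_adjoint_iff]
  intro x y
  induction x using ω.gnsMap_induction with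
  | hc =>
    exact isClosed_eq (Continuous.inner (by fun_prop) continuous_const)
      (Continuous.inner continuous_id continuous_const)
  | ih a =>
    induction y using ω.gnsMap_induction with
    | hc =>
      exact isClosed_eq (Continuous.inner continuous_const continuous_id)
        (Continuous.inner continuous_const (by fun_prop))
    | ih b =>
      simp only [gnsDynamicsCLM_gnsMap, inner_gnsMap]
      conv_rhs => rw [← hinv (-t) (star a * τ t b), map_mul, map_star, ← hτ.map_add_apply,
        neg_add_cancel, hτ.map_zero_apply]

/-- `U_ω(t)` is unitary (Sakai (1991), p. 123; Bratteli–Robinson I Cor. 2.3.17).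
[cite: Sakai1991, §4.2 p. 123] -/
theorem gnsDynamicsCLM_mem_unitary (hτ : IsAutomorphismGroup τ)
    (hinv : ∀ (t : ℝ) (a : A), ω (τ t a) = ω a) (t : ℝ) :
    gnsDynamicsCLM hinv t ∈ unitary (ω.gnsSpace →L[ℂ] ω.gnsSpace) := by
  rw [Unitary.mem_iff, ContinuousLinearMap.star_eq_adjoint, adjoint_gnsDynamicsCLM hτ hinv,
    ← gnsDynamicsCLM_add hτ hinv, ← gnsDynamicsCLM_add hτ hinv, neg_add_cancel, add_neg_cancel,
    gnsDynamicsCLM_zero hτ hinv]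
  exact ⟨rfl, rfl⟩

/-- `U_ω(t)` is isometric. [cite: Sakai1991, §4.2 p. 123] -/
@[simp]
theorem norm_gnsDynamicsCLM (hτ : IsAutomorphismGroup τ)
    (hinv : ∀ (t : ℝ) (a : A), ω (τ t a) = ω a) (t : ℝ) (x : ω.gnsSpace) :
    ‖gnsDynamicsCLM hinv t x‖ = ‖x‖ :=
  (gnsDynamicsCLM hinv t).norm_map_of_mem_unitary (gnsDynamicsCLM_mem_unitary hτ hinv t) x

/-- **Strong continuity of `U_ω`**: `t ↦ U_ω(t) x` is continuous for every `x ∈ 𝓗_ω`. On the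
dense set of classes `[a]` this is `‖U_ω(t)[a] - U_ω(s)[a]‖ ≤ ‖τ_t(a) - τ_s(a)‖` and norm
continuity of `t ↦ τ_t(a)`; in general by uniform approximation, the `U_ω(t)` being isometries
(Bratteli–Robinson I p. 236; Sakai (1991), p. 124). [cite: Sakai1991, §4.2 p. 124] -/
theorem continuous_gnsDynamicsCLM_apply (hτ : IsAutomorphismGroup τ)
    (hinv : ∀ (t : ℝ) (a : A), ω (τ t a) = ω a) (x : ω.gnsSpace) :
    Continuous fun t : ℝ => gnsDynamicsCLM hinv t x := by
  have hU : TendstoUniformly (fun (y : ω.gnsSpace) (t : ℝ) => gnsDynamicsCLM hinv t y)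
      (fun t => gnsDynamicsCLM hinv t x) (𝓝 x) := by
    rw [Metric.tendstoUniformly_iff]
    intro ε hε
    filter_upwards [Metric.ball_mem_nhds x hε] with y hy t
    rw [dist_eq_norm, ← map_sub, norm_gnsDynamicsCLM hτ hinv, ← dist_eq_norm, dist_comm]
    exact hy
  refine hU.continuous ?_
  have hx : x ∈ closure (Set.range ω.gnsMap) := by
    rw [ω.denseRange_gnsMap.closure_range]; exact Set.mem_univ x
  rw [mem_closure_iff_frequently] at hx
  refine hx.mono ?_
  rintro _ ⟨a, rfl⟩
  simp only [gnsDynamicsCLM_gnsMap]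
  exact ω.gnsMap.continuous.comp (hτ.continuous_apply a)

/-- **The GNS unitary group of an invariant state** (Bratteli–Robinson I Cor. 2.3.17; Sakai
(1991), pp. 123–124): for a strongly continuous automorphism group `τ` and a `τ`-invariant state
`ω`, the strongly continuous one-parameter unitary group `U_ω(t) [a] = [τ_t a]` on `𝓗_ω`.
[cite: Sakai1991, §4.2 pp. 123–124] -/
def gnsUnitaryGroup (hτ : IsAutomorphismGroup τ) (hinv : ∀ (t : ℝ) (a : A), ω (τ t a) = ω a) :
    Literature.Analysis.UnboundedOperators.OneParameterUnitaryGroup ω.gnsSpace where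
  toMonoidHom :=
    { toFun := fun g => gnsDynamicsCLM hinv (Multiplicative.toAdd g)
      map_one' := by rw [toAdd_one, gnsDynamicsCLM_zero hτ hinv]
      map_mul' := fun g h => by rw [toAdd_mul, gnsDynamicsCLM_add hτ hinv] }
  strongly_continuous := fun x => (continuous_gnsDynamicsCLM_apply hτ hinv x).comp continuous_toAdd
  mem_unitary := fun g => gnsDynamicsCLM_mem_unitary hτ hinv _

/-- `U_ω(t)` of the bundled group is `gnsDynamicsCLM`. [folklore] -/
@[simp]
theorem gnsUnitaryGroup_appReal (hτ : IsAutomorphismGroup τ)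
    (hinv : ∀ (t : ℝ) (a : A), ω (τ t a) = ω a) (t : ℝ) :
    (gnsUnitaryGroup hτ hinv).appReal t = gnsDynamicsCLM hinv t :=
  rfl

/-- `star U_ω(t) = U_ω(-t)`. [folklore] -/
theorem star_gnsDynamicsCLM (hτ : IsAutomorphismGroup τ)
    (hinv : ∀ (t : ℝ) (a : A), ω (τ t a) = ω a) (t : ℝ) :
    star (gnsDynamicsCLM hinv t) = gnsDynamicsCLM hinv (-t) := by
  rw [ContinuousLinearMap.star_eq_adjoint, adjoint_gnsDynamicsCLM hτ hinv]

/-- **`U_ω` implements `τ` and fixes `Ω_ω`** (Bratteli–Robinson I Cor. 2.3.17; Sakai (1991),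
p. 124, covariance `U_ω(t) π_ω(a) U_ω(-t) = π_ω(τ_t(a))`): `π_ω(τ_t(a)) = U_ω(t) π_ω(a) U_ω(t)⋆`
and `U_ω(t) Ω_ω = Ω_ω`. [cite: Sakai1991, §4.2 p. 124] -/
theorem isGNSImplementationOf_gnsUnitaryGroup (hτ : IsAutomorphismGroup τ)
    (hinv : ∀ (t : ℝ) (a : A), ω (τ t a) = ω a) :
    ω.IsGNSImplementationOf τ (gnsUnitaryGroup hτ hinv) := by
  refine ⟨fun t a => ?_, fun t => ?_⟩
  · rw [gnsUnitaryGroup_appReal, star_gnsDynamicsCLM hτ hinv]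
    ext x
    induction x using ω.gnsMap_induction with
    | hc => exact isClosed_eq (by fun_prop) (by fun_prop)
    | ih b =>
      simp only [mul_apply_eq_comp, gnsDynamicsCLM_gnsMap, gnsRep_gnsMap, map_mul,
        ← hτ.map_add_apply, add_neg_cancel, hτ.map_zero_apply]
  · rw [gnsUnitaryGroup_appReal, gnsVector_eq_gnsMap_one, gnsDynamicsCLM_gnsMap, _root_.map_one]

/-! ### Uniqueness of the implementing unitary group (BR I Cor. 2.3.17) -/

/-- An implementing unitary group fixing `Ω_ω` acts on the classes by `U(t) [a] = [τ_t a]`: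
`U(t) π_ω(a) Ω_ω = U(t) π_ω(a) U(t)⋆ Ω_ω = π_ω(τ_t a) Ω_ω` (Bratteli–Robinson I Cor. 2.3.17,
uniqueness). [cite: BratteliRobinsonI1987, Cor. 2.3.17] -/
theorem IsGNSImplementationOf.appReal_gnsMap {U : Literature.Analysis.UnboundedOperators.OneParameterUnitaryGroup ω.gnsSpace}
    (hU : ω.IsGNSImplementationOf τ U) (t : ℝ) (a : A) :
    U.appReal t (ω.gnsMap a) = ω.gnsMap (τ t a) := by
  have h2 : star (U.appReal t) ω.gnsVector = ω.gnsVector := by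
    rw [ContinuousLinearMap.star_eq_adjoint, Literature.Analysis.UnboundedOperators.UnitaryRep.appReal, U.adjoint_apply, ← ofAdd_neg]
    exact hU.2 (-t)
  calc U.appReal t (ω.gnsMap a)
      = (U.appReal t * ω.gnsRep a * star (U.appReal t)) ω.gnsVector := by
        rw [mul_apply_eq_comp, mul_apply_eq_comp, h2, gnsRep_gnsVector_eq_gnsMap]
    _ = ω.gnsMap (τ t a) := by rw [← hU.1 t a, gnsRep_gnsVector_eq_gnsMap]

/-- **Uniqueness of the GNS implementation** (Bratteli–Robinson I Cor. 2.3.17): two strongly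
continuous unitary groups implementing `τ` in `π_ω` and fixing `Ω_ω` coincide (they agree on the
dense set `π_ω(A) Ω_ω`). [cite: BratteliRobinsonI1987, Cor. 2.3.17] -/
theorem IsGNSImplementationOf.unique {U U' : Literature.Analysis.UnboundedOperators.OneParameterUnitaryGroup ω.gnsSpace}
    (hU : ω.IsGNSImplementationOf τ U) (hU' : ω.IsGNSImplementationOf τ U') : U = U' := by
  refine Literature.Analysis.UnboundedOperators.UnitaryRep.ext fun g => ?_
  change U.appReal (Multiplicative.toAdd g) = U'.appReal (Multiplicative.toAdd g)
  refine ContinuousLinearMap.ext fun x => congrFun (ω.denseRange_gnsMap.equalizer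
    (U.appReal _).continuous (U'.appReal _).continuous (funext fun a => ?_)) x
  simp only [Function.comp_apply, hU.appReal_gnsMap, hU'.appReal_gnsMap]

/-! ### Positivity of the GNS Hamiltonian of a ground state (Sakai 4.2.3; BR II Prop. 5.3.19) -/

/-- **The GNS Hamiltonian of a ground state is positive** (Sakai (1991), Prop. 4.2.3;
Bratteli–Robinson II Prop. 5.3.19 (3), Cor. 5.3.20): `H_ω ≥ 0` in the form sense for the Stone
generator of `U_ω`. Proof via the mollifier criterion `UnitaryRep.hasPositiveEnergy_of_dense`
on the dense set of classes `[a]`: with `m = ∫₀ᵗ τ_s(a) ds ∈ D(δ)`, `δ(m) = τ_t(a) - a`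
(Engel–Nagel Lemma II.1.3), one has `Im ⟪∫₀ᵗ U_ω(s)[a] ds, U_ω(t)[a] - [a]⟫ = Im ω(m⋆ δ(m))
= Re (-i ω(m⋆ δ(m))) ≥ 0` by the ground-state inequality. [cite: Sakai1991, Prop. 4.2.3] -/
theorem hasPositiveEnergy_gnsUnitaryGroup (hτ : IsAutomorphismGroup τ) (hω : ω.IsGroundState τ)
    (hinv : ∀ (t : ℝ) (a : A), ω (τ t a) = ω a) :
    (gnsUnitaryGroup hτ hinv).HasPositiveEnergy := by
  refine Literature.Analysis.UnboundedOperators.UnitaryRep.hasPositiveEnergy_of_dense _ ω.denseRange_gnsMap ?_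
  rintro _ ⟨a, rfl⟩ t _
  simp only [gnsUnitaryGroup_appReal, gnsDynamicsCLM_gnsMap]
  rw [ω.gnsMap.intervalIntegral_comp_comm ((hτ.continuous_apply a).intervalIntegrable _ _),
    ← map_sub, inner_gnsMap]
  have := hω _ _ (hτ.hasDerivAt_integral a t)
  rw [Complex.nonneg_iff] at this
  simpa using this.1

/-- **Existence and uniqueness of the positive-energy GNS implementation of a ground state**
(Sakai (1991), Props. 4.2.2–4.2.3; Bratteli–Robinson II Prop. 5.3.19 (3), Cor. 5.3.20;
Bratteli–Robinson I Cor. 2.3.17): for a strongly continuous automorphism group `τ` of a unital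
C⋆-algebra and a ground state `ω`, there is a unique strongly continuous one-parameter unitary
group on `𝓗_ω` implementing `τ` and fixing `Ω_ω`, and its Hamiltonian is positive.
[cite: Sakai1991, Prop. 4.2.3] -/
theorem IsGroundState.existsUnique_gnsImplementation (hτ : IsAutomorphismGroup τ)
    (hω : ω.IsGroundState τ) :
    ∃! U : Literature.Analysis.UnboundedOperators.OneParameterUnitaryGroup ω.gnsSpace,
      ω.IsGNSImplementationOf τ U ∧ U.HasPositiveEnergy := by
  have hinv : ∀ (t : ℝ) (a : A), ω (τ t a) = ω a := fun t a =>
    IsGroundState.apply_dynamics_holds hτ hω t a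
  refine ⟨gnsUnitaryGroup hτ hinv, ⟨isGNSImplementationOf_gnsUnitaryGroup hτ hinv,
    hasPositiveEnergy_gnsUnitaryGroup hτ hω hinv⟩, ?_⟩
  rintro U ⟨hU, -⟩
  exact hU.unique (isGNSImplementationOf_gnsUnitaryGroup hτ hinv)

end State

end GNS

/-! ### Discharge of `QuasiLocalAlgebra.exists_gnsHamiltonian` -/

section QLattice
namespace QuasiLocalAlgebra

/-- **Discharge** of the named fact `QuasiLocalAlgebra.exists_gnsHamiltonian` (the GNS
Hamiltonian of a ground state of the quasi-local algebra: existence, uniqueness and positivity of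
the implementing unitary group), by specialising `State.IsGroundState.existsUnique_gnsImplementation`
to the carrier of the quasi-local algebra. Sakai (1991), Props. 4.2.2–4.2.3; Bratteli–Robinson II
Prop. 5.3.19 (3) and Cor. 5.3.20; Bratteli–Robinson I Cor. 2.3.17.
[cite: Sakai1991, Prop. 4.2.3] [cite: BratteliRobinsonII1997, Prop. 5.3.19 (3) and Cor. 5.3.20] -/
theorem exists_gnsHamiltonian_holds {d q : ℕ} (𝔄 : QuasiLocalAlgebra d q) :
    𝔄.exists_gnsHamiltonian := by
  intro τ hτ ω hω
  exact State.IsGroundState.existsUnique_gnsImplementation hτ hω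

end QuasiLocalAlgebra
end QLattice

end Literature.MathematicalPhysics.QuantumLattice
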